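import Literature.RepresentationTheory.BorelWallach2000.UpqCasimirTensor
import HarnessLib

/-!
# The `𝔨`-part of the Casimir tensor of `U(α, β)` is `Ad(K)`-invariant

Topic `NumberTheory/Automorphic`; namespace `Literature.NumberTheory.Automorphic`. Theorems with proofs and one definition
with body (`upqAdK`); no named fact, no `sorry`.

For `G = U(α, β)` (`uFormGroup α β`), `K = G ∩ U(N)`, `𝔨 ⊆ 𝔤 = 𝔲(α, β)` and the trace form `B(X, Y) = Re tr(XY)` with its
pseudo-orthonormal basis `(w_a)` of `𝔨` (★ `upqKBasis` ∕ `upqKVec`, `B(w_a, w_b) = −δ_ab`, ★ `upqKDual a = −w_a`):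
`upqTraceFormK_nondegenerate` (`B|_𝔨` is non-degenerate — it is negative definite), `upqAdK k` (`Ad k|_𝔨` as a linear
automorphism of `𝔨`, ★ `upq_Ad_mem_kInLie`) with `coe_upqAdK`, `upqTraceFormK_upqAdK` (`Ad k|_𝔨` preserves `B|_𝔨`),
`upqTraceFormK_dualBasis_upqKBasis` (the `B|_𝔨`-dual basis of `(w_a)` is `(−w_a)`), and
**`upq_kCasimirTensor_AdK_invariant`**: `Σ_a Ad(k) w_a ⊗ Ad(k) w'_a = Σ_a w_a ⊗ w'_a` for `k ∈ K` — the hypothesis `hTK`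
of ★ `GKCasimir.op_commK` for the `𝔨`-part ALONE of the Casimir tensor of ★ `UpqCasimirTensor` (there the full tensor
`Σ x_s ⊗ x_s − Σ w_a ⊗ w_a` is treated), so that the `K`-Casimir `Ω_K = Σ_a w_a w'_a` of a `(𝔤, K)`-module commutes
with `K`.  A. W. Knapp, *Lie groups beyond an introduction* (2002), V.§4 (invariance of the Casimir tensor under
`B`-orthogonal automorphisms); N. Bourbaki, LIE I §3.7 Prop. 11; A. Borel, N. Wallach (2000), II §1.1 (5), §1.3 (2).
-/

noncomputable section

open scoped TensorProduct

namespace Literature.NumberTheory.Automorphic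

open Literature.Algebra.Lie
open Literature.RepresentationTheory.KonnoKonno2007 Literature.RepresentationTheory.KonnoKonno2007.RealDualPair
open Literature.RepresentationTheory.KonnoKonno2007.RealDualPair.UForm
open Literature.RepresentationTheory.BorelWallach2000

-- Mathlib idiom (as in `GKModules`, `GKCohomologyCasimir`): commutator bracket on `Module.End` / matrices
attribute [local instance 100] LieRing.ofAssociativeRing

variable {α β : Type*} [Fintype α] [DecidableEq α] [Fintype β] [DecidableEq β]

/-! ## §0 The `𝔨`-part of the Casimir tensor is `Ad(K)`-invariant -/

/-- **`B|_𝔨` is non-degenerate** (it is negative definite, ★ `upqTraceForm_self_neg_of_mem_kInLie`).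
[cite: BorelWallach2000, II §1.1 (5)] -/
theorem upqTraceFormK_nondegenerate : (upqTraceFormK α β).Nondegenerate := by
  have key : ∀ u : (uFormGroup α β).kInLie, upqTraceFormK α β u u = 0 → u = 0 := by
    intro u hu
    by_contra h0
    have hne : (u : (uFormGroup α β).lie) ≠ 0 := by
      intro h
      apply h0
      exact Subtype.ext h
    have hlt := upqTraceForm_self_neg_of_mem_kInLie (u : (uFormGroup α β).lie) u.2 hne
    rw [upqTraceFormK_apply] at hu
    exact hlt.ne hu
  exact ⟨fun u hu => key u (hu u), fun u hu => key u (hu u)⟩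

/-- `Ad k` (`k ∈ K`) restricted to `𝔨`, as a linear automorphism of `𝔨` (★ `upq_Ad_mem_kInLie`; inverse `Ad k⁻¹`).
[cite: Knapp2002, V.§4] -/
def upqAdK (k : (uFormGroup α β).maximalCompact) : (uFormGroup α β).kInLie ≃ₗ[ℝ] (uFormGroup α β).kInLie where
  toFun u := ⟨(uFormGroup α β).Ad (Subgroup.inclusion (uFormGroup α β).maximalCompact_le_carrier k) u,
    upq_Ad_mem_kInLie k u u.2⟩
  map_add' u v := by
    ext1
    exact map_add _ (u : (uFormGroup α β).lie) (v : (uFormGroup α β).lie)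
  map_smul' c u := by
    ext1
    exact map_smul _ c (u : (uFormGroup α β).lie)
  invFun u := ⟨(uFormGroup α β).Ad (Subgroup.inclusion (uFormGroup α β).maximalCompact_le_carrier k⁻¹) u,
    upq_Ad_mem_kInLie k⁻¹ u u.2⟩
  left_inv u := by
    ext1
    change (uFormGroup α β).Ad (Subgroup.inclusion (uFormGroup α β).maximalCompact_le_carrier k⁻¹)
      ((uFormGroup α β).Ad (Subgroup.inclusion (uFormGroup α β).maximalCompact_le_carrier k) u) = u
    rw [← LieHom.comp_apply, ← RealMatrixGroup.Ad_mul, map_inv, inv_mul_cancel, RealMatrixGroup.Ad_one,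
      LieHom.id_apply]
  right_inv u := by
    ext1
    change (uFormGroup α β).Ad (Subgroup.inclusion (uFormGroup α β).maximalCompact_le_carrier k)
      ((uFormGroup α β).Ad (Subgroup.inclusion (uFormGroup α β).maximalCompact_le_carrier k⁻¹) u) = u
    rw [← LieHom.comp_apply, ← RealMatrixGroup.Ad_mul, map_inv, mul_inv_cancel, RealMatrixGroup.Ad_one,
      LieHom.id_apply]

/-- `upqAdK k u = Ad k u` in `𝔤`. [cite: Knapp2002, V.§4] -/
@[simp] theorem coe_upqAdK (k : (uFormGroup α β).maximalCompact) (u : (uFormGroup α β).kInLie) :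
    ((upqAdK k u : (uFormGroup α β).kInLie) : (uFormGroup α β).lie) =
      (uFormGroup α β).Ad (Subgroup.inclusion (uFormGroup α β).maximalCompact_le_carrier k) u := rfl

/-- `Ad k|_𝔨` preserves `B|_𝔨`. [cite: BorelWallach2000, II §1.1] -/
theorem upqTraceFormK_upqAdK (k : (uFormGroup α β).maximalCompact) (u v : (uFormGroup α β).kInLie) :
    upqTraceFormK α β (upqAdK k u) (upqAdK k v) = upqTraceFormK α β u v := by
  rw [upqTraceFormK_apply, upqTraceFormK_apply, coe_upqAdK, coe_upqAdK, upqTraceForm_Ad]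

/-- **The `B|_𝔨`-dual basis of the pseudo-orthonormal `(w_a)` is `(−w_a)`.** [cite: BorelWallach2000, II §1.1 (5), §1.3 (2)] -/
theorem upqTraceFormK_dualBasis_upqKBasis (a : Fin (upqKDim α β)) :
    (upqTraceFormK α β).dualBasis upqTraceFormK_nondegenerate (upqKBasis α β) a = -upqKBasis α β a := by
  rw [← sub_eq_zero]
  refine upqTraceFormK_nondegenerate.1 _ fun v => ?_
  have h : upqTraceFormK α β
      ((upqTraceFormK α β).dualBasis upqTraceFormK_nondegenerate (upqKBasis α β) a - -upqKBasis α β a) = 0 :=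
    (upqKBasis α β).ext fun b => by
      rw [map_sub, LinearMap.sub_apply, LinearMap.BilinForm.apply_dualBasis_left, map_neg, LinearMap.neg_apply,
        upqTraceFormK_upqKBasis, LinearMap.zero_apply]
      by_cases hab : a = b
      · subst hab
        simp
      · rw [if_neg (Ne.symm hab), if_neg hab, neg_zero, sub_zero]
  rw [h, LinearMap.zero_apply]

/-- **The `𝔨`-part `Σ_a w_a ⊗ w'_a` of the Casimir tensor is `Ad(K)`-invariant** (`Ad k|_𝔨` is `B|_𝔨`-orthogonal, ★
`sum_map_basis_tmul_dualBasis`). [cite: Knapp2002, V.§4] -/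
theorem upq_kCasimirTensor_AdK_invariant (k : (uFormGroup α β).maximalCompact) :
    ∑ a, (uFormGroup α β).Ad (Subgroup.inclusion (uFormGroup α β).maximalCompact_le_carrier k) (upqKVec α β a) ⊗ₜ[ℝ]
        (uFormGroup α β).Ad (Subgroup.inclusion (uFormGroup α β).maximalCompact_le_carrier k) (upqKDual α β a) =
      ∑ a, upqKVec α β a ⊗ₜ[ℝ] upqKDual α β a := by
  have h := sum_map_basis_tmul_dualBasis upqTraceFormK_nondegenerate upqTraceFormK_isSymm (upqKBasis α β)
    (upqAdK k) (fun u v => upqTraceFormK_upqAdK k u v)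
  simp only [upqTraceFormK_dualBasis_upqKBasis, map_neg, TensorProduct.tmul_neg, Finset.sum_neg_distrib,
    neg_inj] at h
  have h2 := congrArg (TensorProduct.map (uFormGroup α β).kInLie.incl.toLinearMap
    (uFormGroup α β).kInLie.incl.toLinearMap) h
  simp only [map_sum, TensorProduct.map_tmul] at h2
  simp only [upqKDual_eq_neg, map_neg, TensorProduct.tmul_neg, Finset.sum_neg_distrib, neg_inj]
  exact h2

end Literature.NumberTheory.Automorphic

end
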